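import Summits.MatrixMultiplication.MatrixMultiplication.Theorems.SoloInformedSupportSubrank
import Literature.Computability.AlgebraicComplexity.SliceRankInstability
import HarnessLib

/-!
# The support-subrank principle, Kronecker powers and instability: the engine of Theorem Π

Solo-informed seat (MatrixMultiplication), gen 109 (paper/theoremB2.md §9.4).

The triangle support of the `k`-th direct power `𝒞₀^{⊗k}` of a configuration is the `k`-th power of
the triangle support of `𝒞₀`, so a realization of `⟨n,n,n⟩` in `𝒞₀^{⊗k}` is a realization for the
coordinatewise triangle predicate. If `Z : Cl³ → K` is ANY re-weighting of the triangle support of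
`𝒞₀` over ANY field (support exactly the triangle relation), then `Z^{⊗k}` re-weights the triangle
support of the power, and the support-subrank principle (`realization_behrend_le_of_hasSliceRankLE`)
gives `N² e^{-4√log N} ≤ slicerank(Z^{⊗k})` for every realization of `⟨3N,3N,3N⟩` in the power
(`realizationPow_behrend_le_sliceRank`). If moreover `Z` is `ε`-UNSTABLE in the sense of
BCCGNSU 2017 Def. 4.4 (proved in the tree: `sliceRank_kroneckerPow_le_of_isEpsUnstable`, Thm 4.10), then
`N² e^{-4√log N} ≤ 3·|Cl|^k·e^{-2kε²}` (`realizationPow_behrend_le_of_isEpsUnstable`): the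
matrix-multiplication capacity of the family `{𝒞₀^{⊗k}}_k` is strictly below the Cohn–Umans target
`1/2` as soon as ONE full-support unstable re-weighting of the triangle support exists over SOME field
("Theorem Π"; for the trivial scheme the golden tensor of `SoloInformedSupportSubrank` is such a
re-weighting with the explicit count `3·2^{h(1/3)k}`).

References: CohnUmans2013 (arXiv:1207.6528) Def. 12, §5, Conj. 21;
BlasiakChurchCohnGrochowNaslundSawinUmans2017 (arXiv:1605.06702) Def. 4.4, Thm 4.10; Sawin 2018
(arXiv:1702.00905).
-/

noncomputable section

open scoped BigOperators
open Finset Literature.Combinatorics.Additive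
open Literature.Barriers.MatrixMultiplication (sliceRank hasSliceRankLE_iff_sliceRank_le)
open Literature.Computability.AlgebraicComplexity (kroneckerPow IsEpsUnstable
  sliceRank_kroneckerPow_le_of_isEpsUnstable)

namespace Summit.MatrixMultiplication.MatrixMultiplication.Theorems.SupportSubrank

variable {Cl : Type} [Fintype Cl] {K : Type} [Field K]

omit [Fintype Cl] in
/-- The support of a Kronecker power is the power of the support. -/
theorem kroneckerPow_ne_zero_iff (Tri : Cl → Cl → Cl → Prop) (Z : Cl → Cl → Cl → K)
    (hZ : ∀ u v w, Z u v w ≠ 0 ↔ Tri u v w) (k : ℕ) (u v w : Fin k → Cl) :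
    kroneckerPow Z k u v w ≠ 0 ↔ ∀ ℓ, Tri (u ℓ) (v ℓ) (w ℓ) := by
  rw [Literature.Computability.AlgebraicComplexity.kroneckerPow_apply, Finset.prod_ne_zero_iff]
  simp only [Finset.mem_univ, forall_true_left, hZ]

/-- **Σ for direct powers.** A realization of `⟨3N,3N,3N⟩` in the `k`-th direct power of a
configuration with triangle predicate `Tri` forces `N² e^{-4√(log N)} ≤ slicerank_K(Z^{⊗k})` for every
field `K` and every `Z` with support exactly `Tri`. [this work] -/
theorem realizationPow_behrend_le_sliceRank (Tri : Cl → Cl → Cl → Prop) (Z : Cl → Cl → Cl → K)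
    (hZ : ∀ u v w, Z u v w ≠ 0 ↔ Tri u v w) (k N : ℕ)
    (α β γ : Fin (3 * N) × Fin (3 * N) → (Fin k → Cl))
    (hreal : ∀ x y z : Fin (3 * N) × Fin (3 * N),
      (∀ ℓ, Tri (α x ℓ) (β y ℓ) (γ z ℓ)) ↔ (y.1 = x.2 ∧ z = (y.2, x.1))) :
    (N : ℝ) ^ 2 * Real.exp (-4 * Real.sqrt (Real.log N)) ≤ sliceRank (kroneckerPow Z k) := by
  have hr : HasSliceRankLE (kroneckerPow Z k) (sliceRank (kroneckerPow Z k)) :=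
    (hasSliceRankLE_iff_sliceRank_le _ _).2 le_rfl
  exact realization_behrend_le_of_hasSliceRankLE (fun u v w => ∀ ℓ, Tri (u ℓ) (v ℓ) (w ℓ))
    (kroneckerPow Z k) (kroneckerPow_ne_zero_iff Tri Z hZ k) hr N α β γ hreal

/-- **Theorem Π (engine).** If the triangle support `Tri` of a configuration with class set `Cl`
carries an `ε`-unstable re-weighting `Z` over some field (BCCGNSU Def. 4.4; support of `Z` exactly
`Tri`), then every realization of `⟨3N,3N,3N⟩` in the `k`-th direct power (`k ≥ 1`) satisfies
`N² e^{-4√(log N)} ≤ 3·|Cl|^k·e^{-2kε²}` — capacity `≤ 1/2 − ε²/log|Cl| < 1/2`. [this work; the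
slice-rank step is BCCGNSU 2017 Thm 4.10, proved in the tree] -/
theorem realizationPow_behrend_le_of_isEpsUnstable (Tri : Cl → Cl → Cl → Prop)
    (Z : Cl → Cl → Cl → K) (hZ : ∀ u v w, Z u v w ≠ 0 ↔ Tri u v w) {ε : ℝ} (hε : 0 ≤ ε)
    (hU : IsEpsUnstable Z ε) (k : ℕ) (hk : 1 ≤ k) (N : ℕ)
    (α β γ : Fin (3 * N) × Fin (3 * N) → (Fin k → Cl))
    (hreal : ∀ x y z : Fin (3 * N) × Fin (3 * N),
      (∀ ℓ, Tri (α x ℓ) (β y ℓ) (γ z ℓ)) ↔ (y.1 = x.2 ∧ z = (y.2, x.1))) :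
    (N : ℝ) ^ 2 * Real.exp (-4 * Real.sqrt (Real.log N)) ≤
      3 * (Fintype.card Cl : ℝ) ^ k * Real.exp (-2 * k * ε ^ 2) := by
  have h1 := realizationPow_behrend_le_sliceRank Tri Z hZ k N α β γ hreal
  have h2 := sliceRank_kroneckerPow_le_of_isEpsUnstable Z hε hU k hk
  linarith

end Summit.MatrixMultiplication.MatrixMultiplication.Theorems.SupportSubrank
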